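import Summits.Ventures.CertifiedManyBodySolver.Rows.DopedTLCorrFilling
import Literature.MathematicalPhysics.QuantumLattice.HubbardNNNHoppingTorusLimitCorrelatorWindow
import HarnessLib

/-!
# The density-parametrised rows are KERNEL-GROUNDED: a `t–t'` window certificate (two energy half-spaces,
# filling rows `Σ_σ μ_σ (n_{0σ} − ν)`) IS a window-N row AND an affine-N row with slope `s = ½ Σ_σ μ_σ`

HONEST FRAMING: soundness edge only; no number, no claim node, no claim on any ground state. Seat
hubbard-downfold-unc-2 (`prover-hubbard-downfold-unc-2-g12-0`), companion of `Rows/DopedTLCorrFilling.lean`.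

`Rows/DopedTLCorrFilling.lean` §A typed `SquareTTPrimeCorrOrbitLowerRowWN tp U lo hi r s n₀ S Λ X` as «what one window
certificate proves at EVERY density» and cited the tree's soundness theorem
`InfVolFermionState.IsTorusLimitOf.re_sum_expect_d4_ge_of_window_certificate_TT'_ineq_of_window`
(`Literature/…/HubbardNNNHoppingTorusLimitCorrelatorWindow`) for the reading `r = c − Σₖ‖aₖ‖ + (Σ_σ μ_σ)(n₀/2 − ν)`,
`s = ½ Σ_σ μ_σ`. This file PROVES that reading: from the raw window identity (objective `Xw ∈ 𝔄_{Λ'}`, constant `c`,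
density multipliers `μ_σ` and slot `ν`, energy rows `κ₊ (hi·1 − Γ E^{1,t'}_Φ) + κ₋ (Γ E^{1,t'}_Φ − lo·1)` with
`κ₊, κ₋ ≥ 0`, Gram part, eom / symmetry / charged / anti-Hermitian / residual blocks — the binder list of the
soundness theorem VERBATIM at `t = 1`) and rational slots `lo', hi', r, s, n₀` with `lo ≤ lo'`, `hi' ≤ hi`,
`s = ½ Σ_σ μ_σ` and `r ≤ c − Σₖ‖aₖ‖ + (Σ_σ μ_σ)(n₀/2 − ν)`, the predicate
`SquareTTPrimeCorrOrbitLowerRowWN tp U lo' hi' r s n₀ S Λ' Xw` holds (`….of_window_certificate`): the soundness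
theorem is applied AT EACH DENSITY `x ∈ [0, 2)` of the predicate's binder, the certificate identity being
density-free. And `SquareTTPrimeCorrAffineOrbitLowerRowN.of_window_certificate`: the AFFINE-N (Lagrangian) row
follows from the same identity by RE-BOOKING both energy rows to the unknown energy `e₀(tp, U, x)` itself (the
constant absorbs `κhi(hi − e₀) + κlo(e₀ − lo)`; the soundness theorem is applied with the trivial window
`e₀ ≤ e₀ ≤ e₀`) — so the weak-duality inequality (★) of `Rows/DopedTLCorrAffine.lean`, there justified in prose,
is a KERNEL consequence of the Literature theorem, at every density. A producer who lands a certificate in Lean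
gets both N-rows — hence the filling-segment box rows and stiffness leaves of `Rows/DopedTLCorrFilling.lean` §C /
`Observables/StiffnessFillingSegmentLeaf.lean` — with no further input; a producer who states a claim node in the
N-shape states exactly these conclusions.

References: J. Wang et al., PRX 14 (2024) 031006, §III eq. (obsopt) [WangEtAl2024]; X. Han, arXiv:2006.06002
(2020), §3 [Han2020Bootstrap].
-/

noncomputable section

namespace Summit.Ventures.CertifiedManyBodySolver

open Literature.MathematicalPhysics.QuantumLattice
open Literature.MathematicalPhysics.QuantumManyBody.StateRelaxation
open Matrix Finset HubbardWave0 Literature.Probability.LatticeModels ThermodynamicLimit Filter Topology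
open scoped ComplexOrder BigOperators

/-- **Window certificate ⇒ window-N orbit row.** A two-half-space window identity of the `t–t'` Hubbard model
(`t = 1`, NNN hopping `tp`, coupling `U ≥ 0`; data as in
`IsTorusLimitOf.re_sum_expect_d4_ge_of_window_certificate_TT'_ineq_of_window`) with `κ₊, κ₋ ≥ 0`, and rational slots
with `lo ≤ lo'`, `hi' ≤ hi`, `s = ½ Σ_σ μ_σ`, `r ≤ c − Σₖ‖aₖ‖ + (Σ_σ μ_σ)(n₀/2 − ν)`, give
`SquareTTPrimeCorrOrbitLowerRowWN tp U lo' hi' r s n₀ S Λ' Xw`: at every density `x ∈ [0, 2)` whose energy lies in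
`[lo', hi'] ⊆ [lo, hi]`, every torus-limit ground state `ω` of density `x` has
`r + s(x − n₀) ≤ |S|⁻¹ Σ_{γ∈S} Re ω_{γΛ'}(Γ(d4Emb γ 0) Xw)`. [cite: WangEtAl2024, §III] -/
theorem SquareTTPrimeCorrOrbitLowerRowWN.of_window_certificate
    (tp : ℝ) {U : ℝ} (hU : 0 ≤ U) {κp κm lo hi : ℝ} (hκp : 0 ≤ κp) (hκm : 0 ≤ κm)
    {Λ Λ' : Finset (Site 2)} (hΛ : Λ ⊆ Λ') (h8 : thicken Λ 1 ⊆ Λ')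
    (h0 : thicken ({0} : Finset (Site 2)) 1 ⊆ Λ') (hz : (0 : Site 2) ∈ Λ')
    {S : Finset (DihedralGroup 4)} (h1 : (1 : DihedralGroup 4) ∈ S) (hmul : ∀ a ∈ S, ∀ b ∈ S, a * b ∈ S)
    (Xw : FermionOp Λ') (μ : Fin 2 → ℝ) (ν : ℝ)
    {m : Type*} [Fintype m] [DecidableEq m] {Λm : Matrix m m ℂ} (hΛm : Λm.PosSemidef)
    (O : m → FermionOp Λ')
    {κ' : Type*} (sB : Finset κ') (B : κ' → FermionOp Λ)
    {ι : Type*} (tt : Finset ι) (γ : ι → DihedralGroup 4) (hγS : ∀ l ∈ tt, γ l ∈ S) (wv : ι → Site 2)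
    (hsh : ∀ l, d4ShiftSet (γ l) (wv l) Λ ⊆ Λ') (Y : ι → FermionOp Λ)
    {ρ : Type*} (uu : Finset ρ) (b : ρ → ℂ) (cw : ρ → List (Orb (PolySite Λ') × Bool))
    (hcw : ∀ j ∈ uu, ladderCharge (cw j) ≠ 0 ∨ ladderSpinCharge (cw j) ≠ 0)
    {δ : Type*} (ah : Finset δ) (dc : δ → ℝ) (V : δ → FermionOp Λ')
    {κ'' : Type*} (w : Finset κ'') (a : κ'' → ℂ) (word : κ'' → List (Orb (PolySite Λ') × Bool)) {c : ℝ}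
    (hcert : Xw - (c : ℂ) • (1 : FermionOp Λ') -
        ∑ σ : Fin 2, ((μ σ : ℝ) : ℂ) • (nAt 0 hz σ - ((ν : ℝ) : ℂ) • (1 : FermionOp Λ')) -
        ((κp : ℝ) : ℂ) • (((hi : ℝ) : ℂ) • (1 : FermionOp Λ') -
          fermionEmbed (PolySite.incl h0) ((hubbardTTPrimeFermionInteraction 1 tp U).meanEnergyObs 1)) -
        ((κm : ℝ) : ℂ) • (fermionEmbed (PolySite.incl h0) ((hubbardTTPrimeFermionInteraction 1 tp U).meanEnergyObs 1) -
          ((lo : ℝ) : ℂ) • (1 : FermionOp Λ')) =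
      gramForm Λm O +
        (∑ k ∈ sB, ((hubbardTTPrimeFermionInteraction 1 tp U).localHamiltonian Λ' * fermionEmbed (PolySite.incl hΛ) (B k) -
            fermionEmbed (PolySite.incl hΛ) (B k) * (hubbardTTPrimeFermionInteraction 1 tp U).localHamiltonian Λ') +
          ∑ l ∈ tt, (fermionEmbed (PolySite.incl (hsh l)) (fermionEmbed (PolySite.d4Emb (γ l) (wv l) Λ) (Y l)) -
            fermionEmbed (PolySite.incl hΛ) (Y l)) +
          ∑ j ∈ uu, b j • ladderWord (cw j)) +
        (∑ m' ∈ ah, ((dc m' : ℝ) : ℂ) • ((V m')ᴴ - V m') + ∑ k ∈ w, a k • ladderWord (word k)))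
    {lo' hi' r s n₀ : ℚ} (hlo' : lo ≤ ((lo' : ℚ) : ℝ)) (hhi' : ((hi' : ℚ) : ℝ) ≤ hi)
    (hs : ((s : ℚ) : ℝ) = (∑ σ : Fin 2, μ σ) / 2)
    (hr : ((r : ℚ) : ℝ) ≤ c - ∑ k ∈ w, ‖a k‖ + (∑ σ : Fin 2, μ σ) * (((n₀ : ℚ) : ℝ) / 2 - ν)) :
    SquareTTPrimeCorrOrbitLowerRowWN tp U lo' hi' r s n₀ S Λ' Xw := by
  intro x hx0 hx2 ω Ls ψ hLs hψ hψ1 hω hl hu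
  have hmain := hω.re_sum_expect_d4_ge_of_window_certificate_TT'_ineq_of_window 1 tp hU hx0 hx2 hκp hκm
    (hlo'.trans hl) (hu.trans hhi') hΛ h8 h0 hz h1 hmul Xw μ ν hΛm O sB B tt γ hγS wv hsh Y uu b cw hcw ah dc V
    w a word hcert hLs hψ hψ1
  have hval : ((r : ℚ) : ℝ) + ((s : ℚ) : ℝ) * (x - ((n₀ : ℚ) : ℝ)) ≤
      c - ∑ k ∈ w, ‖a k‖ + (∑ σ : Fin 2, μ σ) * (x / 2 - ν) := by
    rw [hs]
    have : (∑ σ : Fin 2, μ σ) * (x / 2 - ν) =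
        (∑ σ : Fin 2, μ σ) * (((n₀ : ℚ) : ℝ) / 2 - ν) + (∑ σ : Fin 2, μ σ) / 2 * (x - ((n₀ : ℚ) : ℝ)) := by ring
    rw [this]
    linarith
  exact hval.trans hmain

/-- **Window certificate ⇒ AFFINE-N orbit row (the Lagrangian form, kernel-grounded).** The same two-half-space identity
with RATIONAL multipliers `κhi, κlo ≥ 0` and rows `hi, lo` gives `SquareTTPrimeCorrAffineOrbitLowerRowN tp U q hi lo κhi κlo s n₀ S Λ' Xw`
for every `s = ½ Σ_σ μ_σ` and `q ≤ c − Σₖ‖aₖ‖ + (Σ_σ μ_σ)(n₀/2 − ν)`: at density `x`, RE-BOOK both energy rows to the (unknown, real)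
energy `e = e₀(tp, U, x)` itself — the identity with cap and floor `e` and constant `c + κhi(hi − e) + κlo(e − lo)` is the SAME
operator identity — and apply the soundness theorem with the trivial window `e ≤ e ≤ e`. This derives the weak-duality inequality (★)
of `Rows/DopedTLCorrAffine.lean` (there justified in prose, «one line before the slack is dropped») inside the kernel, at every density.
[cite: BoydVandenberghe2004, §5.6] [cite: WangEtAl2024, §III] -/
theorem SquareTTPrimeCorrAffineOrbitLowerRowN.of_window_certificate
    (tp : ℝ) {U : ℝ} (hU : 0 ≤ U) {κhi κlo hi lo : ℚ} (hκhi : 0 ≤ κhi) (hκlo : 0 ≤ κlo)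
    {Λ Λ' : Finset (Site 2)} (hΛ : Λ ⊆ Λ') (h8 : thicken Λ 1 ⊆ Λ')
    (h0 : thicken ({0} : Finset (Site 2)) 1 ⊆ Λ') (hz : (0 : Site 2) ∈ Λ')
    {S : Finset (DihedralGroup 4)} (h1 : (1 : DihedralGroup 4) ∈ S) (hmul : ∀ a ∈ S, ∀ b ∈ S, a * b ∈ S)
    (Xw : FermionOp Λ') (μ : Fin 2 → ℝ) (ν : ℝ)
    {m : Type*} [Fintype m] [DecidableEq m] {Λm : Matrix m m ℂ} (hΛm : Λm.PosSemidef)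
    (O : m → FermionOp Λ')
    {κ' : Type*} (sB : Finset κ') (B : κ' → FermionOp Λ)
    {ι : Type*} (tt : Finset ι) (γ : ι → DihedralGroup 4) (hγS : ∀ l ∈ tt, γ l ∈ S) (wv : ι → Site 2)
    (hsh : ∀ l, d4ShiftSet (γ l) (wv l) Λ ⊆ Λ') (Y : ι → FermionOp Λ)
    {ρ : Type*} (uu : Finset ρ) (b : ρ → ℂ) (cw : ρ → List (Orb (PolySite Λ') × Bool))
    (hcw : ∀ j ∈ uu, ladderCharge (cw j) ≠ 0 ∨ ladderSpinCharge (cw j) ≠ 0)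
    {δ : Type*} (ah : Finset δ) (dc : δ → ℝ) (V : δ → FermionOp Λ')
    {κ'' : Type*} (w : Finset κ'') (a : κ'' → ℂ) (word : κ'' → List (Orb (PolySite Λ') × Bool)) {c : ℝ}
    (hcert : Xw - (c : ℂ) • (1 : FermionOp Λ') -
        ∑ σ : Fin 2, ((μ σ : ℝ) : ℂ) • (nAt 0 hz σ - ((ν : ℝ) : ℂ) • (1 : FermionOp Λ')) -
        ((((κhi : ℚ) : ℝ) : ℝ) : ℂ) • (((((hi : ℚ) : ℝ) : ℝ) : ℂ) • (1 : FermionOp Λ') -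
          fermionEmbed (PolySite.incl h0) ((hubbardTTPrimeFermionInteraction 1 tp U).meanEnergyObs 1)) -
        ((((κlo : ℚ) : ℝ) : ℝ) : ℂ) • (fermionEmbed (PolySite.incl h0) ((hubbardTTPrimeFermionInteraction 1 tp U).meanEnergyObs 1) -
          ((((lo : ℚ) : ℝ) : ℝ) : ℂ) • (1 : FermionOp Λ')) =
      gramForm Λm O +
        (∑ k ∈ sB, ((hubbardTTPrimeFermionInteraction 1 tp U).localHamiltonian Λ' * fermionEmbed (PolySite.incl hΛ) (B k) -
            fermionEmbed (PolySite.incl hΛ) (B k) * (hubbardTTPrimeFermionInteraction 1 tp U).localHamiltonian Λ') +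
          ∑ l ∈ tt, (fermionEmbed (PolySite.incl (hsh l)) (fermionEmbed (PolySite.d4Emb (γ l) (wv l) Λ) (Y l)) -
            fermionEmbed (PolySite.incl hΛ) (Y l)) +
          ∑ j ∈ uu, b j • ladderWord (cw j)) +
        (∑ m' ∈ ah, ((dc m' : ℝ) : ℂ) • ((V m')ᴴ - V m') + ∑ k ∈ w, a k • ladderWord (word k)))
    {q s n₀ : ℚ} (hs : ((s : ℚ) : ℝ) = (∑ σ : Fin 2, μ σ) / 2)
    (hq : ((q : ℚ) : ℝ) ≤ c - ∑ k ∈ w, ‖a k‖ + (∑ σ : Fin 2, μ σ) * (((n₀ : ℚ) : ℝ) / 2 - ν)) :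
    SquareTTPrimeCorrAffineOrbitLowerRowN tp U q hi lo κhi κlo s n₀ S Λ' Xw := by
  intro x hx0 hx2 ω Ls ψ hLs hψ hψ1 hω
  set E : FermionOp Λ' := fermionEmbed (PolySite.incl h0) ((hubbardTTPrimeFermionInteraction 1 tp U).meanEnergyObs 1)
    with hE
  set e : ℝ := energyDensityTT' 1 tp U x with he
  -- re-book both energy rows to the energy `e` itself: the same operator identity
  have hcert' : Xw - (((c + ((κhi : ℚ) : ℝ) * (((hi : ℚ) : ℝ) - e) + ((κlo : ℚ) : ℝ) * (e - ((lo : ℚ) : ℝ)) : ℝ)) : ℂ) •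
          (1 : FermionOp Λ') -
        ∑ σ : Fin 2, ((μ σ : ℝ) : ℂ) • (nAt 0 hz σ - ((ν : ℝ) : ℂ) • (1 : FermionOp Λ')) -
        ((((κhi : ℚ) : ℝ) : ℝ) : ℂ) • (((e : ℝ) : ℂ) • (1 : FermionOp Λ') - E) -
        ((((κlo : ℚ) : ℝ) : ℝ) : ℂ) • (E - ((e : ℝ) : ℂ) • (1 : FermionOp Λ')) =
      gramForm Λm O +
        (∑ k ∈ sB, ((hubbardTTPrimeFermionInteraction 1 tp U).localHamiltonian Λ' * fermionEmbed (PolySite.incl hΛ) (B k) -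
            fermionEmbed (PolySite.incl hΛ) (B k) * (hubbardTTPrimeFermionInteraction 1 tp U).localHamiltonian Λ') +
          ∑ l ∈ tt, (fermionEmbed (PolySite.incl (hsh l)) (fermionEmbed (PolySite.d4Emb (γ l) (wv l) Λ) (Y l)) -
            fermionEmbed (PolySite.incl hΛ) (Y l)) +
          ∑ j ∈ uu, b j • ladderWord (cw j)) +
        (∑ m' ∈ ah, ((dc m' : ℝ) : ℂ) • ((V m')ᴴ - V m') + ∑ k ∈ w, a k • ladderWord (word k)) := by
    rw [← hcert]
    push_cast
    module
  have hmain := hω.re_sum_expect_d4_ge_of_window_certificate_TT'_ineq_of_window 1 tp hU hx0 hx2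
    (κp := ((κhi : ℚ) : ℝ)) (κm := ((κlo : ℚ) : ℝ)) (lo := e) (hi := e) (by exact_mod_cast hκhi)
    (by exact_mod_cast hκlo) (le_refl e) (le_refl e) hΛ h8 h0 hz h1 hmul Xw μ ν hΛm O sB B tt γ hγS wv hsh Y uu b cw
    hcw ah dc V w a word hcert' hLs hψ hψ1
  have hval : ((q : ℚ) : ℝ) + ((s : ℚ) : ℝ) * (x - ((n₀ : ℚ) : ℝ)) +
        ((κhi : ℚ) : ℝ) * (((hi : ℚ) : ℝ) - e) + ((κlo : ℚ) : ℝ) * (e - ((lo : ℚ) : ℝ)) ≤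
      c + ((κhi : ℚ) : ℝ) * (((hi : ℚ) : ℝ) - e) + ((κlo : ℚ) : ℝ) * (e - ((lo : ℚ) : ℝ)) - ∑ k ∈ w, ‖a k‖ +
        (∑ σ : Fin 2, μ σ) * (x / 2 - ν) := by
    rw [hs]
    have : (∑ σ : Fin 2, μ σ) * (x / 2 - ν) =
        (∑ σ : Fin 2, μ σ) * (((n₀ : ℚ) : ℝ) / 2 - ν) + (∑ σ : Fin 2, μ σ) / 2 * (x - ((n₀ : ℚ) : ℝ)) := by ring
    rw [this]
    linarith
  exact hval.trans hmain

end Summit.Ventures.CertifiedManyBodySolver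

end
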